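import Literature.NumberTheory.LFunctions.Zhang2022.Section2MainOrder
import Literature.NumberTheory.LFunctions.HeckeLOneBound

/-!
# Zhang (2022) §§1–2: the assembly of the argument, typed

Trunk T-ANT (NumberTheory/LFunctions). Y. Zhang, *Discrete mean estimates and the Landau–Siegel
zero*, arXiv:2211.02515v1 (2022) [Zhang2022LandauSiegel] — an unrefereed manuscript under
adjudication. **Nothing in this file asserts or denies its Theorems 1–2 or its Propositions
2.1–2.6.** It kernel-checks the LOGICAL SKELETON by which §2 (pp. 5–6) assembles Theorem 1 from the
discrete means, and the one-line deduction of Theorem 2 from Theorem 1 (§1, p. 3), i.e. the places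
where the constants of §§8–18 (certified in `Section8Certificate`, `Section18Certificate`,
`Section10Certificate`, combined in `Section2MainOrder`) are CONSUMED.

**The skeleton (verbatim structure of §2).** For `ψ ∈ Ψ₁` and `ρ ∈ 𝒵(ψ)` the manuscript has real
weights `𝔠*(ρ,ψ) ≥ 0` (Lemma 2.3) and `ω(ρ) > 0` ((2.15), `ρ` on the critical line by Prop. 2.2
(i)), values `H₁, H₂, J₁, J₂` of Dirichlet polynomials and `Z = Z(ρ,ψχ)` with `|Z| = 1`. Over this
finite family it forms `Ξ₁*` (2.17), `Ξ₂*` (2.19), `Ξ₃*` (2.20), the left sides `Ξ₁` of (2.32)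
(= (8.1), split as (8.2) `Ξ₁ = Ξ₁₁ + Ξ₁₂ + 2Re Ξ₁₃`) and `Ξ_J` of (2.33). We model exactly this:
`EndgameData` = a finite index type with `cstar ≥ 0`, `omega > 0`, `‖Z‖ = 1` and arbitrary complex
`H₁ H₂ J₁ J₂`.

**Proved here (axioms `propext`, `Classical.choice`, `Quot.sound`).**
* `form216_nonneg` — (2.16): Lemma 2.3 ⇒ `Σ 𝔠*|𝔥|²ω ≥ 0` for every `𝔥`.
* `cross_identity`, `norm_Z_mul_conj_sub`, `norm_cross_le` — the three displays before (2.18);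
  `norm_xiStar1_le` — **(2.18) `|Ξ₁*| ≤ Ξ₂* + Ξ₃*`**; `xi1_eq` — **(8.2)**.
* `xiStar2_le_sqrt` — "Cauchy's inequality (and Lemma 2.3)": `Ξ₂* ≤ √(Ξ₁·Ξ_J)`;
  `prop25_of_ineq232_233` — **(2.32) ∧ (2.33) ⇒ Proposition 2.5** (`√(0.001·3000) = √3 < 2`).
* `false_of_props` — "(2.18), Proposition 2.4, 2.5 and 2.6 ⇒ contradiction", with the EXACT
  tolerance the assembly grants Proposition 2.6: `Ξ₃* ≤ 3𝔞𝔓` suffices (`5 = 2 + 3`).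
* `ineq232_of_mainTerms` — (8.23), (9.7), (18.1) with the printed (8.24), (9.8), (18.2) give (2.32)
  iff the three relative `o(𝔓)` errors total `< 0.001 − 0.0008 = 0.0002` (each `η ≤ 5·10⁻⁵`):
  the printed margin of the whole argument, made explicit.
* `le_sqrt_add_of_skeleton` — the general closing condition: `|Ξ₁*| ≥ d𝔞𝔓`, `Ξ₁ ≤ q𝔞𝔓`,
  `Ξ_J ≤ c_J𝔞𝔓`, `Ξ₃* ≤ ε𝔞𝔓` force `d ≤ √(q·c_J) + ε`; so the five inputs are contradictory as
  soon as `√(q·c_J) + ε < d` (`false_of_closing`), which for `ε → 0` is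
  `Section2MainOrder.MainOrderContradiction` (`false_of_mainOrderContradiction`) — this justifies
  that definition as THE closing condition of §2.
* `oneTermModel`, `exists_consistent`, `exists_consistent_of_not_mainOrderContradiction`,
  **`exists_consistent_certified`** — conversely, when `d ≤ √(q·c_J)` a ONE-TERM datum obeying
  Lemma 2.3 and `|Z| = 1` realises `|Ξ₁*| ≥ d𝔞𝔓`, `Ξ₁ = q𝔞𝔓`, `Ξ_J = c_J𝔞𝔓`, `Ξ₃* = 0` at once (so
  the "iff" in `Section2MainOrder.MainOrderContradiction` is a theorem about the skeleton, both
  ways); with the certified main-order constants in each of the four readings (`|𝔡′+𝔡| < 5.2991 <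
  11.87 < √(C₂₃₂·C₂₃₃)`, `Section2MainOrder.not_mainOrderContradiction_all`) such a datum EXISTS —
  the precise sense in which "the final step of §2 does not close": (2.18) cannot contradict the
  four discrete-mean facts at their certified main-order values. (This says nothing about the
  manuscript's actual sums; it says the §2 skeleton extracts no contradiction from those values.)
* `zeroFree_of_LOne_lower_bound`, **`theorem2_of_theorem1`** — §1 "As a direct consequence of
  Theorem 1 we have Theorem 2", i.e. `2024 = 2022 + 2`: PROVED for every non-principal quadratic
  character from the tree's Montgomery–Vaughan (11.10) `1 − β₁ ≪ L(1,χ) ≪ (1 − β₁)(log q)²`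
  (`MontgomeryVaughan2007_thm11_4_LOne_exceptional_holds`) and Mathlib's non-vanishing on `σ ≥ 1`;
  the unstated input is exactly `L′(σ,χ) ≪ log²q` near `1`, which is where `+2` comes from.
* `norm_LFunction_shift_lt` — the same `+2` inside the proof: Lemma 3.1 [p. 7], "if `|s| = α*`,
  `α* = 𝓛⁻²⁰²⁴`, then `L(1+s,χ) ≪ 𝓛⁻²⁰²²` by (A) and standard estimates" = (A) + a bound
  `‖L′‖ ≤ C𝓛²` on the disc (hypothesis) + the mean value inequality; `lemma31_residue_exponents` —
  the ML-inequality bookkeeping `−2024 + 2·2024 − 2·2022 + 9 = −2011` (3.2) and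
  `−2024 + 8·(2024 − 2022) + 1 = −2007` (Lemma 3.2).

**Deliberately NOT here.** Propositions 2.1–2.6, Lemma 2.3, Lemma 5.7 (`𝔞 ≫ 1`) themselves; the
evaluation of any discrete mean (that is §§7–18: `Section8*`, `Section9*`, `Section10*`,
`Section18*`, `AppendixB`); any statement about `L(1,χ)`. Companion prose: the cell's DAG.md §§0–3.
-/

noncomputable section

open Complex Real ComplexConjugate Finset

namespace Literature.NumberTheory.LFunctions.Zhang2022

/-! ## The data of (2.16)–(2.20), (2.32)–(2.33), (8.1)–(8.5) -/

/-- The finite family of §2: for each index (a pair `(ψ, ρ)`, `ψ ∈ Ψ₁`, `ρ ∈ 𝒵(ψ)`) the weight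
`𝔠*(ρ,ψ) ≥ 0` (Lemma 2.3), the weight `ω(ρ) > 0` ((2.15), positive on `σ = 1/2`), the values
`H₁, H₂, J₁, J₂` ((2.27), (2.29), (2.30)) and `Z = Z(ρ, ψχ)` with `|Z| = 1` (Prop. 2.2 (i): `ρ` on
the critical line). [cite: Zhang2022LandauSiegel, §2 (2.14)–(2.17), Lemma 2.3] -/
structure EndgameData (ι : Type*) where
  /-- `𝔠*(ρ,ψ)` -/
  cstar : ι → ℝ
  /-- `ω(ρ)` -/
  omega : ι → ℝ
  /-- `H₁(ρ,ψ)` -/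
  H₁ : ι → ℂ
  /-- `H₂(ρ,ψ)` -/
  H₂ : ι → ℂ
  /-- `J₁(ρ,ψ)` -/
  J₁ : ι → ℂ
  /-- `J₂(ρ,ψ)` -/
  J₂ : ι → ℂ
  /-- `Z(ρ,ψχ)` -/
  Z : ι → ℂ
  /-- Lemma 2.3 -/
  cstar_nonneg : ∀ i, 0 ≤ cstar i
  /-- (2.15) "which is positive for `σ = 1/2`" -/
  omega_pos : ∀ i, 0 < omega i
  /-- `|Z(s,ψχ)| = 1` if `σ = 1/2` -/
  norm_Z : ∀ i, ‖Z i‖ = 1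

namespace EndgameData

variable {ι : Type*} [Fintype ι] (E : EndgameData ι)

/-- The left side of (2.16) for a test function `𝔥`: `Σ 𝔠*(ρ,ψ)|𝔥(ρ,ψ)|²ω(ρ)`.
[cite: Zhang2022LandauSiegel, §2 (2.16)] -/
def form216 (h : ι → ℂ) : ℝ := ∑ i, E.cstar i * ‖h i‖ ^ 2 * E.omega i

/-- `Ξ₁* = Σ 𝔠*(H₁J̄₁ + H̄₂J₂)ω`. [cite: Zhang2022LandauSiegel, §2 (2.17)] -/
def xiStar1 : ℂ :=
  ∑ i, (E.cstar i : ℂ) * (E.H₁ i * conj (E.J₁ i) + conj (E.H₂ i) * E.J₂ i) * E.omega i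

/-- `Ξ₂* = Σ 𝔠*|H₁ + ZH̄₂||J₁|ω`. [cite: Zhang2022LandauSiegel, §2 (2.19)] -/
def xiStar2 : ℝ := ∑ i, E.cstar i * (‖E.H₁ i + E.Z i * conj (E.H₂ i)‖ * ‖E.J₁ i‖) * E.omega i

/-- `Ξ₃* = Σ 𝔠*|J₁ − ZJ̄₂||H₂|ω`. [cite: Zhang2022LandauSiegel, §2 (2.20)] -/
def xiStar3 : ℝ := ∑ i, E.cstar i * (‖E.J₁ i - E.Z i * conj (E.J₂ i)‖ * ‖E.H₂ i‖) * E.omega i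

/-- `Ξ₁ = Σ 𝔠*|H₁ + ZH̄₂|²ω`, the left side of (2.32) (= (8.1)).
[cite: Zhang2022LandauSiegel, §2 (2.32), §8 (8.1)] -/
def xi1 : ℝ := ∑ i, E.cstar i * ‖E.H₁ i + E.Z i * conj (E.H₂ i)‖ ^ 2 * E.omega i

/-- `Ξ₁₁ = Σ 𝔠*|H₁|²ω`. [cite: Zhang2022LandauSiegel, §8 (8.3)] -/
def xi11 : ℝ := ∑ i, E.cstar i * ‖E.H₁ i‖ ^ 2 * E.omega i

/-- `Ξ₁₂ = Σ 𝔠*|H₂|²ω`. [cite: Zhang2022LandauSiegel, §8 (8.4)] -/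
def xi12 : ℝ := ∑ i, E.cstar i * ‖E.H₂ i‖ ^ 2 * E.omega i

/-- `Ξ₁₃ = Σ 𝔠* Z⁻¹H₁H₂ ω`. [cite: Zhang2022LandauSiegel, §8 (8.5)] -/
def xi13 : ℂ := ∑ i, (E.cstar i : ℂ) * ((E.Z i)⁻¹ * E.H₁ i * E.H₂ i) * E.omega i

/-- `Ξ_J = Σ 𝔠*|J₁|²ω`, the left side of (2.33). [cite: Zhang2022LandauSiegel, §2 (2.33)] -/
def xiJ : ℝ := ∑ i, E.cstar i * ‖E.J₁ i‖ ^ 2 * E.omega i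

/-- **(2.16)**: by Lemma 2.3 (and `ω > 0`), `Σ 𝔠*|𝔥|²ω ≥ 0` for every `𝔥`.
[cite: Zhang2022LandauSiegel, §2 (2.16)] -/
theorem form216_nonneg (h : ι → ℂ) : 0 ≤ E.form216 h :=
  Finset.sum_nonneg fun i _ =>
    mul_nonneg (mul_nonneg (E.cstar_nonneg i) (sq_nonneg _)) (E.omega_pos i).le

/-- `Ξ₁` is (2.16) with `𝔥 = H₁ + ZH̄₂`. [folklore] -/
theorem xi1_eq_form216 : E.xi1 = E.form216 fun i => E.H₁ i + E.Z i * conj (E.H₂ i) := rfl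

/-- `Ξ_J` is (2.16) with `𝔥 = J₁`. [folklore] -/
theorem xiJ_eq_form216 : E.xiJ = E.form216 E.J₁ := rfl

/-- `Ξ₁ ≥ 0`. [folklore] -/
theorem xi1_nonneg : 0 ≤ E.xi1 := E.form216_nonneg _

/-- `Ξ_J ≥ 0`. [folklore] -/
theorem xiJ_nonneg : 0 ≤ E.xiJ := E.form216_nonneg _

/-- `Ξ₂* ≥ 0`. [folklore] -/
theorem xiStar2_nonneg : 0 ≤ E.xiStar2 :=
  Finset.sum_nonneg fun i _ =>
    mul_nonneg (mul_nonneg (E.cstar_nonneg i) (mul_nonneg (norm_nonneg _) (norm_nonneg _)))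
      (E.omega_pos i).le

/-- `Ξ₃* ≥ 0`. [folklore] -/
theorem xiStar3_nonneg : 0 ≤ E.xiStar3 :=
  Finset.sum_nonneg fun i _ =>
    mul_nonneg (mul_nonneg (E.cstar_nonneg i) (mul_nonneg (norm_nonneg _) (norm_nonneg _)))
      (E.omega_pos i).le

end EndgameData

/-! ## The two displays before (2.18), and (2.18) -/

/-- `H₁J̄₁ + H̄₂J₂ = (H₁ + ZH̄₂)J̄₁ − (ZJ̄₁ − J₂)H̄₂` (first display before (2.18)).
[cite: Zhang2022LandauSiegel, §2, proof of (2.18)] -/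
theorem cross_identity (H₁ H₂ J₁ J₂ Z : ℂ) :
    H₁ * conj J₁ + conj H₂ * J₂ = (H₁ + Z * conj H₂) * conj J₁ - (Z * conj J₁ - J₂) * conj H₂ := by
  ring

/-- `|ZJ̄₁ − J₂| = |J₁ − ZJ̄₂|` when `|Z| = 1` (second display before (2.18)).
[cite: Zhang2022LandauSiegel, §2, proof of (2.18)] -/
theorem norm_Z_mul_conj_sub {Z : ℂ} (hZ : ‖Z‖ = 1) (J₁ J₂ : ℂ) :
    ‖Z * conj J₁ - J₂‖ = ‖J₁ - Z * conj J₂‖ := by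
  have h1 : Z * conj Z = 1 := by rw [Complex.mul_conj, Complex.normSq_eq_norm_sq, hZ]; norm_num
  have h2 : Z * conj J₁ - J₂ = Z * conj (J₁ - Z * conj J₂) := by
    simp only [map_sub, map_mul, Complex.conj_conj]
    linear_combination J₂ * h1
  rw [h2, norm_mul, hZ, one_mul, Complex.norm_conj]

/-- The termwise bound `|H₁J̄₁ + H̄₂J₂| ≤ |H₁ + ZH̄₂||J₁| + |J₁ − ZJ̄₂||H₂|` (third display
before (2.18)). [cite: Zhang2022LandauSiegel, §2, proof of (2.18)] -/
theorem norm_cross_le {Z : ℂ} (hZ : ‖Z‖ = 1) (H₁ H₂ J₁ J₂ : ℂ) :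
    ‖H₁ * conj J₁ + conj H₂ * J₂‖ ≤ ‖H₁ + Z * conj H₂‖ * ‖J₁‖ + ‖J₁ - Z * conj J₂‖ * ‖H₂‖ := by
  rw [cross_identity H₁ H₂ J₁ J₂ Z]
  refine (norm_sub_le _ _).trans (le_of_eq ?_)
  rw [norm_mul, norm_mul, Complex.norm_conj, Complex.norm_conj, norm_Z_mul_conj_sub hZ]

namespace EndgameData

variable {ι : Type*} [Fintype ι] (E : EndgameData ι)

/-- **(2.18)** `|Ξ₁*| ≤ Ξ₂* + Ξ₃*` ("This yields, by Lemma 2.3, …": the weights `𝔠*ω` are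
non-negative, so the termwise bound sums). [cite: Zhang2022LandauSiegel, §2 (2.18)] -/
theorem norm_xiStar1_le : ‖E.xiStar1‖ ≤ E.xiStar2 + E.xiStar3 := by
  unfold xiStar1 xiStar2 xiStar3
  rw [← Finset.sum_add_distrib]
  refine (norm_sum_le _ _).trans (Finset.sum_le_sum fun i _ => ?_)
  have hc := E.cstar_nonneg i
  have hω := (E.omega_pos i).le
  have h := norm_cross_le (E.norm_Z i) (E.H₁ i) (E.H₂ i) (E.J₁ i) (E.J₂ i)
  rw [norm_mul, norm_mul, Complex.norm_real, Complex.norm_real, Real.norm_of_nonneg hc,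
    Real.norm_of_nonneg hω]
  calc E.cstar i * ‖E.H₁ i * conj (E.J₁ i) + conj (E.H₂ i) * E.J₂ i‖ * E.omega i
      ≤ E.cstar i * (‖E.H₁ i + E.Z i * conj (E.H₂ i)‖ * ‖E.J₁ i‖
          + ‖E.J₁ i - E.Z i * conj (E.J₂ i)‖ * ‖E.H₂ i‖) * E.omega i :=
        mul_le_mul_of_nonneg_right (mul_le_mul_of_nonneg_left h hc) hω
    _ = _ := by ring

/-- **(8.2)** `Ξ₁ = Ξ₁₁ + Ξ₁₂ + 2Re Ξ₁₃` ("since `|Z(s,ψχ)| = 1` if `σ = 1/2`": `|H₁ + ZH̄₂|² =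
|H₁|² + |H₂|² + 2Re(Z⁻¹H₁H₂)`). [cite: Zhang2022LandauSiegel, §8 (8.2)] -/
theorem xi1_eq : E.xi1 = E.xi11 + E.xi12 + 2 * E.xi13.re := by
  unfold xi1 xi11 xi12 xi13
  rw [Complex.re_sum, Finset.mul_sum, ← Finset.sum_add_distrib, ← Finset.sum_add_distrib]
  refine Finset.sum_congr rfl fun i _ => ?_
  have hZ := E.norm_Z i
  have hn : Complex.normSq (E.Z i) = 1 := by rw [Complex.normSq_eq_norm_sq, hZ]; norm_num
  have hZinv : (E.Z i)⁻¹ = conj (E.Z i) := by rw [Complex.inv_def, hn]; simp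
  have hsq : ‖E.H₁ i + E.Z i * conj (E.H₂ i)‖ ^ 2
      = ‖E.H₁ i‖ ^ 2 + ‖E.H₂ i‖ ^ 2 + 2 * ((E.Z i)⁻¹ * E.H₁ i * E.H₂ i).re := by
    rw [Complex.sq_norm, Complex.sq_norm, Complex.sq_norm, Complex.normSq_add, Complex.normSq_mul,
      Complex.normSq_conj, hn, one_mul, hZinv, map_mul, Complex.conj_conj]
    congr 2
    ring_nf
  have hre : (((E.cstar i : ℂ) * ((E.Z i)⁻¹ * E.H₁ i * E.H₂ i)) * (E.omega i : ℂ)).re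
      = E.cstar i * ((E.Z i)⁻¹ * E.H₁ i * E.H₂ i).re * E.omega i := by
    rw [Complex.re_mul_ofReal, Complex.re_ofReal_mul]
  rw [hre, hsq]
  ring

/-- "Cauchy's inequality (and Lemma 2.3)": `(Ξ₂*)² ≤ Ξ₁·Ξ_J` (weighted Cauchy–Schwarz, weights
`𝔠*ω ≥ 0`). [cite: Zhang2022LandauSiegel, §2, remark after Prop. 2.6] -/
theorem xiStar2_sq_le : E.xiStar2 ^ 2 ≤ E.xi1 * E.xiJ := by
  unfold xiStar2 xi1 xiJ
  refine Finset.sum_sq_le_sum_mul_sum_of_sq_le_mul _ (fun i _ => ?_) (fun i _ => ?_)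
    (fun i _ => le_of_eq ?_)
  · exact mul_nonneg (mul_nonneg (E.cstar_nonneg i) (sq_nonneg _)) (E.omega_pos i).le
  · exact mul_nonneg (mul_nonneg (E.cstar_nonneg i) (sq_nonneg _)) (E.omega_pos i).le
  · ring

/-- `Ξ₂* ≤ √(Ξ₁·Ξ_J)`. [cite: Zhang2022LandauSiegel, §2, remark after Prop. 2.6] -/
theorem xiStar2_le_sqrt : E.xiStar2 ≤ Real.sqrt (E.xi1 * E.xiJ) :=
  calc E.xiStar2 = Real.sqrt (E.xiStar2 ^ 2) := (Real.sqrt_sq E.xiStar2_nonneg).symm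
    _ ≤ Real.sqrt (E.xi1 * E.xiJ) := Real.sqrt_le_sqrt E.xiStar2_sq_le

/-- **(2.32) ∧ (2.33) ⇒ Proposition 2.5**: `Ξ₁ < 0.001𝔞𝔓` and `Ξ_J < 3000𝔞𝔓` give
`Ξ₂* ≤ √(Ξ₁Ξ_J) < √3·𝔞𝔓 < 2𝔞𝔓` (`aP` stands for `𝔞𝔓 > 0`).
[cite: Zhang2022LandauSiegel, §2 Prop. 2.5, (2.32), (2.33)] -/
theorem prop25_of_ineq232_233 {aP : ℝ} (haP : 0 < aP) (h232 : E.xi1 < 0.001 * aP)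
    (h233 : E.xiJ < 3000 * aP) : E.xiStar2 < 2 * aP := by
  have hsq := E.xiStar2_sq_le
  have h0 := E.xiStar2_nonneg
  have h1 : E.xi1 * E.xiJ ≤ 0.001 * aP * (3000 * aP) :=
    mul_le_mul h232.le h233.le E.xiJ_nonneg (by positivity)
  nlinarith [mul_pos haP haP]

/-- **"Under Assumption (A), a contradiction is immediately derived from (2.18), Proposition 2.4,
2.5 and 2.6"** — with the tolerance made explicit: Prop. 2.6's `Ξ₃* = o(𝔞𝔓)` is consumed only as
`Ξ₃* ≤ 3𝔞𝔓` (`5 = 2 + 3`). [cite: Zhang2022LandauSiegel, §2, p. 6 (proof of Theorem 1)] -/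
theorem false_of_props {aP : ℝ} (h24 : 5 * aP < ‖E.xiStar1‖) (h25 : E.xiStar2 < 2 * aP)
    (h26 : E.xiStar3 ≤ 3 * aP) : False := by
  have h218 := E.norm_xiStar1_le
  linarith

/-- **The printed margin.** If `Ξ₁₁ ≤ (𝔠₁ + η)𝔞𝔓`, `Ξ₁₂ ≤ (𝔠₂ + η)𝔞𝔓`, `Re Ξ₁₃ ≤ (Re 𝔠₃ + η)𝔞𝔓`
((8.23), (9.7), (18.1) — printed with errors `o(𝔓)`, here `η𝔞𝔓`, using `𝔞 ≫ 1` (Lemma 5.7)) and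
the printed (8.24) `𝔠₁ < 6.9955`, (9.8) `𝔠₂ < 6.9955`, (18.2) `Re 𝔠₃ < −6.9951` hold, then (2.32)
`Ξ₁ < 0.001𝔞𝔓` follows PROVIDED `η ≤ 5·10⁻⁵`: the three printed bounds sum to `0.0008` ("It
follows from (8.24), (9.8) and (18.2) that `𝔠₁ + 𝔠₂ + 2Re{𝔠₃} < 0.001`"), leaving `0.0002` for all
the `o(𝔓)` terms together.
[cite: Zhang2022LandauSiegel, §18, proof of Prop. 2.5 (p. 36)] -/
theorem ineq232_of_mainTerms {aP c₁ c₂ c₃ η : ℝ} (haP : 0 < aP)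
    (h11 : E.xi11 ≤ (c₁ + η) * aP) (h12 : E.xi12 ≤ (c₂ + η) * aP) (h13 : E.xi13.re ≤ (c₃ + η) * aP)
    (h824 : c₁ < 6.9955) (h98 : c₂ < 6.9955) (h182 : c₃ < -6.9951) (hη : η ≤ 0.00005) :
    E.xi1 < 0.001 * aP := by
  rw [E.xi1_eq]
  have hgap : (0 : ℝ) < 0.001 - (c₁ + c₂ + 2 * c₃ + 4 * η) := by linarith
  nlinarith [mul_pos hgap haP]

/-- **The closing condition of §2.** If `|Ξ₁*| ≥ d·𝔞𝔓` (Prop. 2.4: `d = 5`; (10.17): `d = |𝔡′+𝔡|`),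
`Ξ₁ ≤ q·𝔞𝔓` ((2.32): `q = 0.001`; §18: `q = 𝔠₁+𝔠₂+2Re 𝔠₃`), `Ξ_J ≤ c_J·𝔞𝔓` ((2.33): `3000`; (18.3))
and `Ξ₃* ≤ ε·𝔞𝔓` (Prop. 2.6), then (2.18) forces `d ≤ √(q·c_J) + ε`. [folklore] -/
theorem le_sqrt_add_of_skeleton {aP d q cJ ε : ℝ} (haP : 0 < aP) (h24 : d * aP ≤ ‖E.xiStar1‖)
    (h232 : E.xi1 ≤ q * aP) (h233 : E.xiJ ≤ cJ * aP) (h26 : E.xiStar3 ≤ ε * aP) :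
    d ≤ Real.sqrt (q * cJ) + ε := by
  have h218 := E.norm_xiStar1_le
  have hq : 0 ≤ q := by have := E.xi1_nonneg; nlinarith
  have hcJ : 0 ≤ cJ := by have := E.xiJ_nonneg; nlinarith
  have h2 : E.xiStar2 ≤ Real.sqrt (q * cJ) * aP :=
    calc E.xiStar2 ≤ Real.sqrt (E.xi1 * E.xiJ) := E.xiStar2_le_sqrt
      _ ≤ Real.sqrt (q * aP * (cJ * aP)) :=
          Real.sqrt_le_sqrt (mul_le_mul h232 h233 E.xiJ_nonneg (by positivity))
      _ = Real.sqrt (q * cJ) * aP := by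
          rw [show q * aP * (cJ * aP) = q * cJ * (aP * aP) by ring,
            Real.sqrt_mul (mul_nonneg hq hcJ), Real.sqrt_mul_self haP.le]
  have h3 : d * aP ≤ (Real.sqrt (q * cJ) + ε) * aP := by nlinarith
  exact le_of_mul_le_mul_right h3 haP

/-- Hence the five inputs are contradictory as soon as `√(q·c_J) + ε < d`. [folklore] -/
theorem false_of_closing {aP d q cJ ε : ℝ} (haP : 0 < aP) (hclose : Real.sqrt (q * cJ) + ε < d)
    (h24 : d * aP ≤ ‖E.xiStar1‖) (h232 : E.xi1 ≤ q * aP) (h233 : E.xiJ ≤ cJ * aP)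
    (h26 : E.xiStar3 ≤ ε * aP) : False :=
  (lt_irrefl d) ((E.le_sqrt_add_of_skeleton haP h24 h232 h233 h26).trans_lt hclose)

/-- In particular `Section2MainOrder.MainOrderContradiction q c_J` (`√(q·c_J) < |𝔡′+𝔡|`) is exactly
what lets SOME `ε > 0` — i.e. Prop. 2.6's `o(𝔞𝔓)` for `D` large — close the argument with
`|Ξ₁*| ≥ |𝔡′+𝔡|𝔞𝔓`. [folklore] -/
theorem false_of_mainOrderContradiction {aP q cJ ε : ℝ} (haP : 0 < aP)
    (hM : MainOrderContradiction q cJ) (hε : ε ≤ (‖dprime + dfrak‖ - Real.sqrt (q * cJ)) / 2)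
    (h24 : ‖dprime + dfrak‖ * aP ≤ ‖E.xiStar1‖) (h232 : E.xi1 ≤ q * aP) (h233 : E.xiJ ≤ cJ * aP)
    (h26 : E.xiStar3 ≤ ε * aP) : False := by
  unfold MainOrderContradiction at hM
  exact E.false_of_closing haP (by linarith) h24 h232 h233 h26

end EndgameData

/-! ## Consistency: when `d ≤ √(q·c_J)` the skeleton yields nothing -/

/-- The one-term datum: `𝔠* = 1`, `ω = 𝔞𝔓`, `H₁ = √a`, `H₂ = 0`, `J₁ = J₂ = √b`, `Z = 1`.
[folklore] -/
def oneTermModel (a b aP : ℝ) (haP : 0 < aP) : EndgameData Unit where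
  cstar := fun _ => 1
  omega := fun _ => aP
  H₁ := fun _ => (Real.sqrt a : ℂ)
  H₂ := fun _ => 0
  J₁ := fun _ => (Real.sqrt b : ℂ)
  J₂ := fun _ => (Real.sqrt b : ℂ)
  Z := fun _ => 1
  cstar_nonneg := fun _ => zero_le_one
  omega_pos := fun _ => haP
  norm_Z := fun _ => norm_one

/-- Its discrete means: `|Ξ₁*| = √(ab)·𝔞𝔓`, `Ξ₁ = a·𝔞𝔓`, `Ξ_J = b·𝔞𝔓`, `Ξ₃* = 0`. [folklore] -/
theorem oneTermModel_values {a b aP : ℝ} (ha : 0 ≤ a) (hb : 0 ≤ b) (haP : 0 < aP) :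
    ‖(oneTermModel a b aP haP).xiStar1‖ = Real.sqrt (a * b) * aP
    ∧ (oneTermModel a b aP haP).xi1 = a * aP ∧ (oneTermModel a b aP haP).xiJ = b * aP
    ∧ (oneTermModel a b aP haP).xiStar3 = 0 := by
  refine ⟨?_, ?_, ?_, ?_⟩
  · simp only [EndgameData.xiStar1, oneTermModel, Finset.univ_unique, Finset.sum_singleton,
      Complex.conj_ofReal, map_zero, zero_mul, add_zero, Complex.ofReal_one, one_mul, norm_mul,
      Complex.norm_real, Real.norm_of_nonneg (Real.sqrt_nonneg _), Real.norm_of_nonneg haP.le,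
      Real.sqrt_mul ha]
  · simp only [EndgameData.xi1, oneTermModel, Finset.univ_unique, Finset.sum_singleton, map_zero,
      mul_zero, add_zero, one_mul, Complex.norm_real, Real.norm_of_nonneg (Real.sqrt_nonneg _),
      Real.sq_sqrt ha]
  · simp only [EndgameData.xiJ, oneTermModel, Finset.univ_unique, Finset.sum_singleton, one_mul,
      Complex.norm_real, Real.norm_of_nonneg (Real.sqrt_nonneg _), Real.sq_sqrt hb]
  · simp only [EndgameData.xiStar3, oneTermModel, Finset.univ_unique, Finset.sum_singleton,
      norm_zero, mul_zero, zero_mul]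

/-- **Consistency.** If `d ≤ √(q·c_J)` then a datum obeying Lemma 2.3 and `|Z| = 1` satisfies
`|Ξ₁*| ≥ d𝔞𝔓`, `Ξ₁ = q𝔞𝔓`, `Ξ_J = c_J𝔞𝔓`, `Ξ₃* = 0` at once: from these four facts (2.18) derives no
contradiction. [folklore] -/
theorem exists_consistent {d q cJ aP : ℝ} (hq : 0 ≤ q) (hcJ : 0 ≤ cJ)
    (hd : d ≤ Real.sqrt (q * cJ)) (haP : 0 < aP) :
    ∃ E : EndgameData Unit,
      d * aP ≤ ‖E.xiStar1‖ ∧ E.xi1 = q * aP ∧ E.xiJ = cJ * aP ∧ E.xiStar3 = 0 := by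
  obtain ⟨h1, h2, h3, h4⟩ := oneTermModel_values hq hcJ haP
  exact ⟨oneTermModel q cJ aP haP, by rw [h1]; exact mul_le_mul_of_nonneg_right hd haP.le,
    h2, h3, h4⟩

/-- Conversely, if `¬ MainOrderContradiction q c_J` (`√(q·c_J) ≥ |𝔡′+𝔡|`) then for every `𝔞𝔓 > 0`
a datum obeying Lemma 2.3 and `|Z| = 1` has `|Ξ₁*| ≥ |𝔡′+𝔡|𝔞𝔓`, `Ξ₁ = q𝔞𝔓`, `Ξ_J = c_J𝔞𝔓` and
`Ξ₃* = 0` (the strongest form of Prop. 2.6): with `false_of_mainOrderContradiction`, the "iff" of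
`Section2MainOrder.MainOrderContradiction` in both directions. [folklore] -/
theorem exists_consistent_of_not_mainOrderContradiction {q cJ aP : ℝ} (hq : 0 ≤ q) (hcJ : 0 ≤ cJ)
    (hM : ¬ MainOrderContradiction q cJ) (haP : 0 < aP) :
    ∃ E : EndgameData Unit, ‖dprime + dfrak‖ * aP ≤ ‖E.xiStar1‖ ∧ E.xi1 = q * aP
      ∧ E.xiJ = cJ * aP ∧ E.xiStar3 = 0 :=
  exists_consistent hq hcJ (not_lt.mp hM) haP

/-- **With the certified constants the §2 skeleton is consistent**, in each of the four readings
(`C₂₃₂`/`C₂₃₂ᶜ` × `C₂₃₃`/`C₂₃₃(lit)`; `Section2MainOrder.not_mainOrderContradiction_all`: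
`|𝔡′+𝔡| < 5.2991 < 11.87 < √(C₂₃₂·C₂₃₃)`): for every `𝔞𝔓 > 0` some datum has `|Ξ₁*| ≥ |𝔡′+𝔡|𝔞𝔓`
((10.17) at main order), `Ξ₁ = C₂₃₂𝔞𝔓` (§18), `Ξ_J = C₂₃₃𝔞𝔓` ((18.3)), `Ξ₃* = 0` (Prop. 2.6), and
(2.18) holds for it. This is the precise content of "the final step does not close" — a statement
about the skeleton of §2, not about the manuscript's sums. [folklore] -/
theorem exists_consistent_certified {aP q cJ : ℝ} (haP : 0 < aP) (hq : q = C232 ∨ q = C232c)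
    (hcJ : cJ = C233 ∨ cJ = C233lit) :
    ∃ E : EndgameData Unit, ‖dprime + dfrak‖ * aP ≤ ‖E.xiStar1‖ ∧ E.xi1 = q * aP
      ∧ E.xiJ = cJ * aP ∧ E.xiStar3 = 0 ∧ ‖E.xiStar1‖ ≤ E.xiStar2 + E.xiStar3 := by
  obtain ⟨h₁, h₂, h₃, h₄⟩ := not_mainOrderContradiction_all
  have hq0 : 0 ≤ q := by rcases hq with rfl | rfl <;> linarith [C232_bounds.1.1, C232_bounds.2.1]
  have hcJ0 : 0 ≤ cJ := by rcases hcJ with rfl | rfl <;> linarith [C233_bounds.1, C233lit_bounds.1]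
  have hM : ¬ MainOrderContradiction q cJ := by
    rcases hq with rfl | rfl <;> rcases hcJ with rfl | rfl <;> assumption
  obtain ⟨E, a, b, c, d⟩ := exists_consistent_of_not_mainOrderContradiction hq0 hcJ0 hM haP
  exact ⟨E, a, b, c, d, E.norm_xiStar1_le⟩

/-! ## Theorem 1 ⇒ Theorem 2: `2024 = 2022 + 2` -/

/-- **A lower bound `L(1,χ) > c₁(log q)^{-A}` gives the zero-free segment
`σ > 1 − c₂(log q)^{-(A+2)}`** for non-principal quadratic `χ` mod `q ≥ 3`, with `c₂ > 0` depending
only on `c₁`: if `L(σ,χ) = 0` with `σ < 1` in that segment then `σ` is an exceptional zero and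
Montgomery–Vaughan (11.10) gives `L(1,χ) ≤ C₂(1−σ)(log q)² < c₁(log q)^{-A}`; for `σ ≥ 1`, `L ≠ 0`
classically. The `+2` is the `(log q)²` of (11.10), i.e. `L′(σ,χ) ≪ log²q` near `1`.
[cite: MontgomeryVaughan2007, Theorem 11.4 (11.10)] -/
theorem zeroFree_of_LOne_lower_bound (A : ℕ) {c₁ : ℝ} (hc₁ : 0 < c₁) :
    ∃ c₂ : ℝ, 0 < c₂ ∧ ∀ (q : ℕ) [NeZero q] (χ : DirichletCharacter ℂ q), χ ≠ 1 → χ.IsQuadratic →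
      3 ≤ q → c₁ * (Real.log q)⁻¹ ^ A < ‖χ.LFunction 1‖ →
        ∀ σ : ℝ, 1 - c₂ * (Real.log q)⁻¹ ^ (A + 2) < σ → χ.LFunction σ ≠ 0 := by
  obtain ⟨c, hc, C₁, C₂, hC₁, hC₂, hF⟩ := MontgomeryVaughan2007_thm11_4_LOne_exceptional_holds
  refine ⟨min (c / 3) (c₁ / C₂), lt_min (by positivity) (by positivity), ?_⟩
  intro q _ χ hχ hquad hq h1 σ hσ
  have hq3 : (3 : ℝ) ≤ q := by exact_mod_cast hq
  have hlog : 1 < Real.log q :=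
    calc (1 : ℝ) < Real.log 3 := by
          rw [Real.lt_log_iff_exp_lt (by norm_num)]
          exact Real.exp_one_lt_d9.trans (by norm_num)
      _ ≤ Real.log q := Real.log_le_log (by norm_num) hq3
  set L := Real.log (q : ℝ) with hL
  have hLpos : 0 < L := by linarith
  have hLinv : 0 < L⁻¹ := inv_pos.mpr hLpos
  have hLinv1 : L⁻¹ ≤ 1 := inv_le_one_of_one_le₀ hlog.le
  by_cases hσ1 : 1 ≤ σ
  · exact χ.LFunction_ne_zero_of_one_le_re (Or.inl hχ) (by simpa using hσ1)
  push Not at hσ1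
  intro hzero
  have hpow : L⁻¹ ^ (A + 2) ≤ L⁻¹ := pow_le_of_le_one hLinv.le hLinv1 (by omega)
  have h4qpos : 0 < Real.log (4 * q) := Real.log_pos (by linarith)
  have h4q : Real.log (4 * q) ≤ 3 * L := log_four_mul_le_three_mul_log (by linarith)
  have step1 : min (c / 3) (c₁ / C₂) * L⁻¹ ^ (A + 2) ≤ c / 3 * L⁻¹ :=
    mul_le_mul (min_le_left _ _) hpow (by positivity) (by positivity)
  have step2 : c / 3 * L⁻¹ ≤ c / Real.log (4 * q) := by
    rw [show c / 3 * L⁻¹ = c / (3 * L) by field_simp]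
    exact div_le_div_of_nonneg_left hc.le h4qpos h4q
  have hreg : 1 - c / Real.log (4 * q) < σ := by linarith
  have hup : ‖χ.LFunction 1‖ ≤ C₂ * (1 - σ) * Real.log q ^ 2 := (hF q χ hχ hquad σ hreg hσ1 hzero).2
  have h1σ : 1 - σ < c₁ / C₂ * L⁻¹ ^ (A + 2) := by
    have := mul_le_mul_of_nonneg_right (min_le_right (c / 3) (c₁ / C₂))
      (pow_nonneg hLinv.le (A + 2))
    linarith
  have key : C₂ * (1 - σ) * L ^ 2 < c₁ * L⁻¹ ^ A := by
    have hL2 : 0 < L ^ 2 := by positivity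
    have hLL : L⁻¹ ^ 2 * L ^ 2 = 1 := by rw [← mul_pow, inv_mul_cancel₀ hLpos.ne', one_pow]
    have hCC : C₂ * (c₁ / C₂) = c₁ := by field_simp
    calc C₂ * (1 - σ) * L ^ 2 < C₂ * (c₁ / C₂ * L⁻¹ ^ (A + 2)) * L ^ 2 := by gcongr
      _ = C₂ * (c₁ / C₂) * (L⁻¹ ^ A * (L⁻¹ ^ 2 * L ^ 2)) := by rw [pow_add]; ring
      _ = c₁ * L⁻¹ ^ A := by rw [hCC, hLL, mul_one]
  rw [← hL] at hup
  linarith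

/-- **Theorem 1 ⇒ Theorem 2 of the manuscript** ("As a direct consequence of Theorem 1 we have
Theorem 2"): for non-principal quadratic `χ` mod `q ≥ 3`, `L(1,χ) > c₁(log q)⁻²⁰²²` implies
`L(σ,χ) ≠ 0` for `σ > 1 − c₂(log q)⁻²⁰²⁴`, `c₂ = c₂(c₁) > 0` effective. The implication is a
theorem; neither side is asserted. [cite: Zhang2022LandauSiegel, §1, Theorems 1–2] -/
theorem theorem2_of_theorem1 {c₁ : ℝ} (hc₁ : 0 < c₁) :
    ∃ c₂ : ℝ, 0 < c₂ ∧ ∀ (q : ℕ) [NeZero q] (χ : DirichletCharacter ℂ q), χ ≠ 1 → χ.IsQuadratic →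
      3 ≤ q → c₁ * (Real.log q)⁻¹ ^ 2022 < ‖χ.LFunction 1‖ →
        ∀ σ : ℝ, 1 - c₂ * (Real.log q)⁻¹ ^ 2024 < σ → χ.LFunction σ ≠ 0 :=
  zeroFree_of_LOne_lower_bound 2022 hc₁

/-! ## The same `+2` inside the proof: Lemma 3.1's contour `|s| = α* = 𝓛⁻²⁰²⁴` -/

/-- Lemma 3.1 [p. 7]: "if `|s| = α*` (`α* = 𝓛⁻²⁰²⁴`) then `L(1+s,χ) ≪ 𝓛⁻²⁰²²` by (A) and standard
estimates" — typed: (A) `‖L(1,χ)‖ < 𝓛⁻²⁰²²` plus a bound `‖L′(z,χ)‖ ≤ C𝓛²` on the disc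
`|z − 1| ≤ 𝓛⁻²⁰²⁴` (the unstated standard estimate) give `‖L(1+s,χ)‖ < (1 + C)𝓛⁻²⁰²²` by the
mean value inequality. [cite: Zhang2022LandauSiegel, §3, proof of Lemma 3.1] -/
theorem norm_LFunction_shift_lt {q : ℕ} [NeZero q] {χ : DirichletCharacter ℂ q} (hχ : χ ≠ 1)
    {L C : ℝ} (hL : 0 < L) (hC : 0 ≤ C)
    (hderiv : ∀ z ∈ Metric.closedBall (1 : ℂ) (L⁻¹ ^ 2024), ‖deriv χ.LFunction z‖ ≤ C * L ^ 2)
    (hA : ‖χ.LFunction 1‖ < L⁻¹ ^ 2022) {s : ℂ} (hs : ‖s‖ ≤ L⁻¹ ^ 2024) :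
    ‖χ.LFunction (1 + s)‖ < (1 + C) * L⁻¹ ^ 2022 := by
  have hmem1 : (1 : ℂ) ∈ Metric.closedBall (1 : ℂ) (L⁻¹ ^ 2024) :=
    Metric.mem_closedBall_self (by positivity)
  have hmem2 : 1 + s ∈ Metric.closedBall (1 : ℂ) (L⁻¹ ^ 2024) := by
    rw [Metric.mem_closedBall, dist_eq_norm, add_sub_cancel_left]; exact hs
  have hmv : ‖χ.LFunction (1 + s) - χ.LFunction 1‖ ≤ C * L ^ 2 * ‖1 + s - 1‖ :=
    Convex.norm_image_sub_le_of_norm_deriv_le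
      (fun z _ => (DirichletCharacter.differentiable_LFunction hχ z)) hderiv
      (convex_closedBall (1 : ℂ) (L⁻¹ ^ 2024)) hmem1 hmem2
  rw [add_sub_cancel_left] at hmv
  have htri : ‖χ.LFunction (1 + s)‖ ≤ ‖χ.LFunction 1‖ + C * L ^ 2 * ‖s‖ := by
    linarith [norm_sub_norm_le (χ.LFunction (1 + s)) (χ.LFunction 1)]
  have hCs : C * L ^ 2 * ‖s‖ ≤ C * L⁻¹ ^ 2022 := by
    calc C * L ^ 2 * ‖s‖ ≤ C * L ^ 2 * L⁻¹ ^ 2024 := by gcongr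
      _ = C * L⁻¹ ^ 2022 := by field_simp
  linarith

/-- The ML-inequality bookkeeping of Lemmas 3.1–3.2 [p. 7]: contour length `≍ 𝓛⁻²⁰²⁴`, integrand
`ζ(1+s)²L(1+s,χ)²(P^{2s}−D^{4s})Γ(s) ≪ 𝓛^{2·2024}·𝓛^{−2·2022}·𝓛⁹` ⇒ residue `≪ 𝓛⁻²⁰¹¹` (3.2); and
`ζ⁸L⁸(D^{8s}−D^{4s})Γ(s) ≪ 𝓛^{8·(2024−2022)}·𝓛` ⇒ `≪ 𝓛⁻²⁰⁰⁷` (Lemma 3.2).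
[cite: Zhang2022LandauSiegel, §3, Lemmas 3.1–3.2] -/
theorem lemma31_residue_exponents :
    (-2024 : ℤ) + (2 * 2024 - 2 * 2022) + 9 = -2011
    ∧ (-2024 : ℤ) + 8 * (2024 - 2022) + 1 = -2007 := by
  norm_num

end Literature.NumberTheory.LFunctions.Zhang2022
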